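import Summits.HodgeConjecture.HodgeConjecture.Theorems.WeilTypeLadderCyclicPrymHodgeRingDescent
import Summits.HodgeConjecture.HodgeConjecture.Theorems.WeilTypeLadderCyclicPrymSixteenCyclicQuartic
import Summits.HodgeConjecture.HodgeConjecture.Theorems.WeilTypeLadderCyclicPrymTwentyBiquadratic
import HarnessLib

/-!
# Weil-type ladder — `HodgeConjectureFor B` shells for the COMPOSITE-level four-point rows (abelian eightfolds, `m = 15, 16, 20`)

Report `HOME/b2b-hweil-pv3-g46/COMPACT-PAIRS.md` (prover 3 gen 46) sorts the ten positive-dimensional `K′`-Weil,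
non-`E`-Weil four-point `ℤ/m`-families of abelian EIGHTFOLDS with `[K′:ℚ] = 4` (case candidates C23–C26, C29, C30;
`E = ℚ(ζ_m)`, `m ∈ {15, 16, 20}`) by Rohde's monodromy criterion (LNM 1975 = arXiv:0711.2195, Ch. 5 Def. 3.5 /
Thm. 3.6 and §4):

* THREE families are VERY GENERAL in Rohde's sense (`(16; 1,2,4,9)` = C26 for the cyclic quartic `ℚ(ζ₁₆)^{⟨7⟩}`;
  `(20; 1,2,4,13)`, `(20; 1,2,6,11)` ⊂ C29 for `ℚ(i, √5)`): `Mon⁰ = Res_{E⁺/ℚ} SU(H¹, φ)` and THEOREM HG″ gives, for the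
  very general member, `End⁰ = E`, Hodge ring `⟨NS, W_{K′}⟩` (`W_{K′} ⊂ H⁴(B, ℚ)` of `ℚ`-dimension 4, exceptional) and
  the Hodge conjecture in every codimension modulo Shioda 1979 Thm. 2 (`m ≤ 20`, two factors) + Fulton + the cell's
  transfer chain — §2 below: the divisor–Weil shells for the two bodies `…Sixteen_cyclicQuartic` / `…Twenty_biquadratic`
  in the descent-free form of `…HodgeRingDescent` (`hdatum` + the `K′`-Weil multiplicity condition `hmult` on `H¹` +
  `hgen`);
* the other SEVEN (`(15; 1,4,5,5)` C23, `(15; 1,9,9,11)` C30, `(16; 1,3,5,7)` C25, `(20; 1,5,5,9)`, `(20; 1,9,15,15)` C24,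
  `(20; 1,4,4,11)`, `(20; 1,11,14,14)` ⊂ C29) are EXCEPTIONAL (Rohde §4, complex case, first system): every member
  carries an extra automorphism `τ` with `τ s τ⁻¹ = s^u` (`u = −v`, `v` the generator of `Gal(E/K′)`), is isogenous to
  the square of an abelian FOURFOLD, its `K′`-Weil classes are PRODUCTS OF DIVISOR CLASSES, and the Hodge ring of the
  very general member is generated by divisor classes (THEOREM EXC) — §1 below: the generic shell
  `hodgeConjectureFor_of_hodgeClassSpan_le_divisorAlgebra` (Hodge ring ⊆ the even cup subalgebra generated by the
  rational `(1,1)`-classes ⟹ `HodgeConjectureFor`, by Lefschetz `(1,1)` and cup-closure — tree theorems; NO named fact).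

HONEST LABEL: shells (case loci); the geometry (`hgen`: THEOREM HG″ (d) resp. THEOREM EXC (d) for the VERY GENERAL
member; `hdatum`: PROPOSITION CYC′; `hmult`: THEOREM W′) enters as explicit binders; imports `WeilTypeLadder*` and
`HarnessLib` only; 0 unconditional rungs above the floor; nothing of [Mar25]/[Mos26]/[Perry]; Markman-free; no `sorry`,
no definition, no new named fact, no `decide`; default heartbeats.
-/

noncomputable section

set_option linter.dupNamespace false

open CategoryTheory MonoidalCategory Polynomial
open Literature.AlgebraicGeometry Literature.AlgebraicGeometry.Motives
open Literature.AlgebraicGeometry.HodgeTheory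
open Literature.AlgebraicGeometry.Deligne1982
open Literature.AlgebraicGeometry.VanGeemen1994 (hodgeClassSpan)
open Literature.AlgebraicTopology.SingularHomology

namespace Summit.HodgeConjecture.HodgeConjecture.WeilTypeLadder

/-! ### §1 Hodge ring generated by divisor classes ⟹ `HodgeConjectureFor` (THEOREM EXC (e), the seven exceptional rows) -/

section DivisorGenerated

/-- `weilClassesField A φ 1 r = ⊥`: the constant polynomial `1` has no complex root, so the span over its roots is
empty. [folklore] -/
theorem weilClassesField_one_eq_bot (A : AbelianVariety ℂ) (φ : A ⟶ A) (r : ℕ) :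
    weilClassesField A φ (1 : Polynomial ℤ) r = ⊥ := by
  rw [eq_bot_iff]
  intro c hc
  rw [mem_weilClassesField_iff] at hc
  simp only [Polynomial.eval₂_one, one_ne_zero, Set.setOf_false, Set.mem_empty_iff_false,
    iSup_false, iSup_bot, Submodule.mem_bot] at hc
  rw [hc]
  exact Submodule.zero_mem _

/-- **`HodgeConjectureFor A` when the Hodge ring is generated by divisor classes** (THEOREM EXC (e) of the report:
the very general member of each of the seven exceptional composite-level four-point families; classically Mattuck /
Tate's remark, Moonen–Zarhin's `D•(X) = B•(X)` case): if every rational `(q,q)`-class of the complex abelian variety `A`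
lies in `divisorWeilAlgebra A (𝟙 A) 1 0 q` — the smallest even cup subalgebra of `H^{2•}(A(ℂ); ℂ)` containing the
rational `(1,1)`-classes (and `weilClassesField A (𝟙 A) 1 0 = ⊥`, `weilClassesField_one_eq_bot`) — then
`HodgeConjectureFor A.dim A.X` (Lefschetz `(1,1)` + cup-closure of algebraic classes, tree theorems behind
`hodgeConjectureFor_of_hodgeClassSpan_le_divisorWeilAlgebra`). [cite: MoonenZarhin1998WeilClasses, §1 (Introduction: D•(X) ⊆ B•(X))]
[cite: VoisinHodgeI2002, Thm. 11.30] -/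
theorem hodgeConjectureFor_of_hodgeClassSpan_le_divisorAlgebra (A : AbelianVariety ℂ)
    (hgen : ∀ q : ℕ, hodgeClassSpan A.dim A.X q ≤ divisorWeilAlgebra A (𝟙 A) 1 0 q) :
    HodgeConjectureFor A.dim A.X :=
  hodgeConjectureFor_of_hodgeClassSpan_le_divisorWeilAlgebra A (𝟙 A) 1 0 hgen
    (by rw [weilClassesField_one_eq_bot]; exact bot_le)

end DivisorGenerated

/-! ### §2 The two very-general composite rows: divisor–Weil shells, descent discharged, `K′`-Weil condition on `H¹` -/

section Instances

/-- **(16, `K′ = ℚ(ζ₁₆)^{⟨7⟩}` cyclic quartic; C26: the family `(1,2,4,9)` of abelian eightfolds at `h = 2`) — THEOREM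
HG″ (e), kernel shell.** Binders of `weilClassesCMField_cyclicPrymSixteen_cyclicQuartic_of_facts` (`B`, `s`, `h`,
`Φ₁₆(s) = 0`, `dim B = 4h`, the Fermat pair `X₁, X₂ = Xʰ₁₆`, `T`, `a` surjective, `b`) + `hdatum` (PROPOSITION CYC′ for
every class of `W_{K′} ⊗ ℂ = weilClassesField B (s + s⁷) (T⁴ + 4T² + 2) (2h)`) + `hmult` (the `K′`-Weil condition
`n_ρ = n_ρ̄` on `H^{1,0}`, THEOREM W′) + `hgen` (THEOREM HG″ (d): for the VERY GENERAL member — Rohde-very-general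
family, maximal torus — every rational Hodge class lies in the divisor–Weil algebra) ⊢ `HodgeConjectureFor B.dim B.X`;
descent by `weilClassesField_le_span_isRationalClass` (Eisenstein irreducibility, `P(s + s⁷) = 0 ⇐ Φ₁₆(s) = 0`),
Hodge type by Deligne's Prop. 4.4 ⟺ (`4·(2h) = 2·dim B`). [cite: Shioda1979PJA, §2 Thm. 2 (p. 112) with the list after Thm. 1]
[cite: Fulton1998, §19.2 Cor. 19.2 (b)] [cite: Rohde2009CyclicCoverings, Ch. 6 Def. 6.3.5, Thm. 6.3.6, Prop. 6.2.2]
[cite: MoonenZarhin1998WeilClasses, §1 (Criterion, Lemma (1))] [cite: Deligne1982HodgeCycles, §4 Prop. 4.4] -/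
theorem hodgeConjectureFor_cyclicPrymSixteen_cyclicQuartic_of_eigenMultiplicity
    (hF₂ : hodgeClasses_algebraic_fermatProduct₂) (hP : fulton1998_map_mem_algebraicClasses) :
    ∀ (B : Motives.AbelianVariety ℂ) (s : B ⟶ B) (h : ℕ),
      Polynomial.eval₂ (Int.castRingHom (CategoryTheory.End B)) (s : CategoryTheory.End B)
        (Polynomial.cyclotomic 16 ℤ) = 0 → B.dim = 4 * h →
    ∀ (X₁ X₂ T : Motives.SchemeOver ℂ),
      IsFermatVariety h 16 X₁ → IsSmoothProjective h X₁ → IsFermatVariety h 16 X₂ → IsSmoothProjective h X₂ →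
      IsSmoothProjective B.dim T →
    ∀ (a : T ⟶ B.X), AlgebraicGeometry.Surjective a.left → ∀ (ι : Type) (b : ι → (T ⟶ X₁ ⊗ X₂)),
      (∀ c ∈ weilClassesField B (s + s ≫ s ≫ s ≫ s ≫ s ≫ s ≫ s) (X ^ 4 + 4 * X ^ 2 + 2 : Polynomial ℤ) (2 * h),
        complexBetti.map a (2 * h) c ∈ (⨆ i, (Submodule.span ℂ
            {x : complexBetti (X₁ ⊗ X₂) (2 * h) |
              IsRationalClass x ∧ IsOfHodgeType (h + h) (X₁ ⊗ X₂) (2 * h) h h x}).map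
              (complexBetti.map (b i) (2 * h)).hom)) →
      (∀ ρ : ℂ, Polynomial.eval₂ (Int.castRingHom ℂ) ρ (X ^ 4 + 4 * X ^ 2 + 2 : Polynomial ℤ) = 0 →
        eigenMultiplicity B (s + s ≫ s ≫ s ≫ s ≫ s ≫ s ≫ s) ρ =
          eigenMultiplicity B (s + s ≫ s ≫ s ≫ s ≫ s ≫ s ≫ s) (starRingEnd ℂ ρ)) →
      (∀ q : ℕ, hodgeClassSpan B.dim B.X q ≤
        divisorWeilAlgebra B (s + s ≫ s ≫ s ≫ s ≫ s ≫ s ≫ s) (X ^ 4 + 4 * X ^ 2 + 2 : Polynomial ℤ) h q) →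
      HodgeConjectureFor B.dim B.X := by
  intro B s h hs hdim X₁ X₂ T hF₁' hX₁ hF₂' hX₂ hT a ha ι b hdatum hmult hgen
  have hφ : Polynomial.eval₂ (Int.castRingHom (CategoryTheory.End B))
      ((s + s ≫ s ≫ s ≫ s ≫ s ≫ s ≫ s : B ⟶ B) : CategoryTheory.End B) (X ^ 4 + 4 * X ^ 2 + 2 : Polynomial ℤ) = 0 := by
    have h7 := eval₂_quarticSixteen_add_pow_seven (CategoryTheory.End.of s) hs
    rwa [← end_of_comp_seven] at h7
  exact hodgeConjectureFor_of_divisorWeil_eigenMultiplicity B _ _ 4 h quarticSixteen_monic quarticSixteen_natDegree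
    quarticSixteen_irreducible hφ (by omega) hmult hgen
    (fun c hcW hc hmm => weilClassesCMField_cyclicPrymSixteen_cyclicQuartic_of_facts hF₂ hP B s h hs hdim X₁ X₂ T
      hF₁' hX₁ hF₂' hX₂ hT a ha ι b c hcW (hdatum c hcW) hc hmm)

/-- **(20, `K′ = ℚ(i, √5)` biquadratic; the two Rohde-very-general families `(1,2,4,13)`, `(1,2,6,11)` of C29, abelian
eightfolds at `h = 2`) — THEOREM HG″ (e), kernel shell.** Binders of `weilClassesCMField_cyclicPrymTwenty_biquadratic_of_facts`
(`B`, `s`, `h`, `Φ₂₀(s) = 0`, `dim B = 4h`, `X₁, X₂ = Xʰ₂₀`, `T`, `a`, `b`) + `hdatum` + `hmult` + `hgen` (for the VERY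
GENERAL member of a Rohde-very-general family; NOT for the two exceptional families `(1,4,4,11)`, `(1,11,14,14)` of the same
row, whose Hodge ring is larger than the divisor–Weil algebra and is divisor-generated instead — §1) ⊢
`HodgeConjectureFor B.dim B.X`; descent by `weilClassesField_le_span_isRationalClass` (`T⁴ + 3T² + 1` irreducible by factor
exclusion, `P(s³ + s⁷) = 0 ⇐ Φ₂₀(s) = 0`), Hodge type by Deligne's Prop. 4.4 ⟺.
[cite: Shioda1979PJA, §2 Thm. 2 (p. 112) with the list after Thm. 1] [cite: Fulton1998, §19.2 Cor. 19.2 (b)]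
[cite: Rohde2009CyclicCoverings, Ch. 6 Def. 6.3.5, Thm. 6.3.6, Prop. 6.2.2] [cite: MoonenZarhin1998WeilClasses, §1 (Criterion, Lemma (1))]
[cite: Deligne1982HodgeCycles, §4 Prop. 4.4] -/
theorem hodgeConjectureFor_cyclicPrymTwenty_biquadratic_of_eigenMultiplicity
    (hF₂ : hodgeClasses_algebraic_fermatProduct₂) (hP : fulton1998_map_mem_algebraicClasses) :
    ∀ (B : Motives.AbelianVariety ℂ) (s : B ⟶ B) (h : ℕ),
      Polynomial.eval₂ (Int.castRingHom (CategoryTheory.End B)) (s : CategoryTheory.End B)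
        (Polynomial.cyclotomic 20 ℤ) = 0 → B.dim = 4 * h →
    ∀ (X₁ X₂ T : Motives.SchemeOver ℂ),
      IsFermatVariety h 20 X₁ → IsSmoothProjective h X₁ → IsFermatVariety h 20 X₂ → IsSmoothProjective h X₂ →
      IsSmoothProjective B.dim T →
    ∀ (a : T ⟶ B.X), AlgebraicGeometry.Surjective a.left → ∀ (ι : Type) (b : ι → (T ⟶ X₁ ⊗ X₂)),
      (∀ c ∈ weilClassesField B (CategoryTheory.End.asHom (CategoryTheory.End.of s ^ 3 + CategoryTheory.End.of s ^ 7))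
          (X ^ 4 + 3 * X ^ 2 + 1 : Polynomial ℤ) (2 * h),
        complexBetti.map a (2 * h) c ∈ (⨆ i, (Submodule.span ℂ
            {x : complexBetti (X₁ ⊗ X₂) (2 * h) |
              IsRationalClass x ∧ IsOfHodgeType (h + h) (X₁ ⊗ X₂) (2 * h) h h x}).map
              (complexBetti.map (b i) (2 * h)).hom)) →
      (∀ ρ : ℂ, Polynomial.eval₂ (Int.castRingHom ℂ) ρ (X ^ 4 + 3 * X ^ 2 + 1 : Polynomial ℤ) = 0 →
        eigenMultiplicity B (CategoryTheory.End.asHom (CategoryTheory.End.of s ^ 3 + CategoryTheory.End.of s ^ 7)) ρ =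
          eigenMultiplicity B (CategoryTheory.End.asHom (CategoryTheory.End.of s ^ 3 + CategoryTheory.End.of s ^ 7))
            (starRingEnd ℂ ρ)) →
      (∀ q : ℕ, hodgeClassSpan B.dim B.X q ≤
        divisorWeilAlgebra B (CategoryTheory.End.asHom (CategoryTheory.End.of s ^ 3 + CategoryTheory.End.of s ^ 7))
          (X ^ 4 + 3 * X ^ 2 + 1 : Polynomial ℤ) h q) →
      HodgeConjectureFor B.dim B.X := by
  intro B s h hs hdim X₁ X₂ T hF₁' hX₁ hF₂' hX₂ hT a ha ι b hdatum hmult hgen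
  have hφ : Polynomial.eval₂ (Int.castRingHom (CategoryTheory.End B))
      ((CategoryTheory.End.asHom (CategoryTheory.End.of s ^ 3 + CategoryTheory.End.of s ^ 7) : B ⟶ B) :
        CategoryTheory.End B) (X ^ 4 + 3 * X ^ 2 + 1 : Polynomial ℤ) = 0 :=
    eval₂_quarticTwentyGolden_phi (CategoryTheory.End.of s) hs
  exact hodgeConjectureFor_of_divisorWeil_eigenMultiplicity B _ _ 4 h quarticTwentyGolden_monic
    quarticTwentyGolden_natDegree quarticTwentyGolden_irreducible hφ (by omega) hmult hgen
    (fun c hcW hc hmm => weilClassesCMField_cyclicPrymTwenty_biquadratic_of_facts hF₂ hP B s h hs hdim X₁ X₂ T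
      hF₁' hX₁ hF₂' hX₂ hT a ha ι b c hcW (hdatum c hcW) hc hmm)

/-! On path: every conclusion above is `HodgeConjectureFor B.dim B.X` for a complex abelian variety `B`, a CASE of the
summit (`hodgeConjectureFor_abelianVariety_of_hodgeConjecture`, tree lemma, imported through `…HodgeRing`). -/

/-- Sanity (on path): the summit gives the conclusion of every theorem of this file outright. [cite: Deligne2000, §1] -/
example (hH : _root_.HodgeConjecture) (B : AbelianVariety ℂ) : HodgeConjectureFor B.dim B.X :=
  hodgeConjectureFor_abelianVariety_of_hodgeConjecture hH B

end Instances

end Summit.HodgeConjecture.HodgeConjecture.WeilTypeLadder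

end
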